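import Literature.Computability.Cryptography.RegevSamplerClassical
import Literature.Computability.QuantumComplexity.QFTKit
import HarnessLib

/-!
# Regev 2009, Lemma 3.14 in machine form: the standard register layout

Topic `Literature/Computability/Cryptography`, grouping namespace `Regev2009.SamplerClassical`; sequel of
`RegevSamplerClassical.lean`. Every machine-side theorem of the sampler (`RegevSamplerMachine*`) is stated over an
abstract register layout `Λ : Layout W n` with the well-formedness `Λ.OK`, the fit of the three classical blocks `Fits Λ`
and the room condition `base + n·qbsize ℓ_R k_F ≤ W` of the Fourier stage as hypotheses. This file discharges them by
the STANDARD LAYOUT: the zones are the first `T = nℓ + L + nℓ_Y + nℓ_R + n b_c` wires in order (`loc = id`), the work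
window starts at `base = T`, and the register width `stdW` is one more than the largest of the three block tops and the
Fourier room. All statements are offset arithmetic.

* `stdLayout n ℓ ℓY ℓR bc L Lq W hW : Layout W n`; `stdLayout_OK` (from `Lq ≤ L`, `nℓ, nℓ_Y, nℓ_R ≤ L`, `T ≤ W`);
* `topY/topS/topX` — the three block tops as numbers independent of `W`; `stdLayout_fits`;
* `stdW` and `stdW_pos`, `fits_stdW`, `room_stdW`, `OK_stdW`.

Everything here is proved; no named fact is introduced.

## References

* O. Regev, *On lattices, learning with errors, random linear codes, and cryptography*, J. ACM 56 (2009),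
  art. 34, Lemma 3.14 (proof: the registers of the sampler) [Regev2009].
* P. W. Shor, *Polynomial-time algorithms for prime factorization and discrete logarithms on a quantum
  computer*, SIAM J. Comput. 26 (1997), §3 p. 8 (clean reversible blocks with work space) [Shor1997].
-/

noncomputable section

namespace Literature.Computability.Cryptography

namespace Regev2009

namespace SamplerClassical

open Literature.Computability.Complexity Literature.Computability.QuantumComplexity SamplerWordFns
  _root_.Computability

/-! ### The standard layout -/

/-- The base of the work window of the standard layout: the total zone length `nℓ + L + nℓ_Y + nℓ_R + n b_c`.
[folklore] -/
def stdBase (n ℓ ℓY ℓR bc L : ℕ) : ℕ := n * ℓ + L + n * ℓY + n * ℓR + n * bc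

/-- **The standard layout**: zones on the first `T` wires in order, work window from `T` on.
[cite: Regev2009, Lemma 3.14 (proof)] -/
def stdLayout (n ℓ ℓY ℓR bc L Lq W : ℕ) (hW : 0 < W) : Layout W n where
  ℓ := ℓ
  ℓY := ℓY
  ℓR := ℓR
  bc := bc
  L := L
  Lq := Lq
  hW := hW
  loc := id
  base := stdBase n ℓ ℓY ℓR bc L

variable (n ℓ ℓY ℓR bc L Lq : ℕ)

/-- The zone count of the standard layout is its base. [folklore] -/
theorem stdLayout_T (W : ℕ) (hW : 0 < W) : (stdLayout n ℓ ℓY ℓR bc L Lq W hW).T = stdBase n ℓ ℓY ℓR bc L := by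
  unfold Layout.T Layout.oA Layout.oS Layout.oY Layout.oU stdBase stdLayout
  simp only

/-- **The standard layout is well formed** once the input zone dominates the registers and the zones fit.
[folklore] -/
theorem stdLayout_OK {W : ℕ} (hW : 0 < W) (hLq : Lq ≤ L) (hX : n * ℓ ≤ L) (hY : n * ℓY ≤ L) (hS : n * ℓR ≤ L)
    (hWb : stdBase n ℓ ℓY ℓR bc L ≤ W) : (stdLayout n ℓ ℓY ℓR bc L Lq W hW).OK where
  loc_inj := fun _ _ _ _ h => h
  loc_lt := fun i hi => by rw [stdLayout_T] at hi; exact hi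
  base_le := hWb
  Lq_le := hLq
  szX := hX
  szY := hY
  szS := hS

/-! ### The block tops -/

/-- Top of the branch block's work window. [folklore] -/
def topY : ℕ :=
  CleanPlaced.top eY MY (n * ℓ + L) (CleanBlockInput.suffix (qYE (n, (ℓ, (ℓY, Lq)))) (n * ℓ + L)) (stdBase n ℓ ℓY ℓR bc L)
/-- Top of the residue block's work window. [folklore] -/
def topS : ℕ :=
  CleanPlaced.top eS MS (n * ℓ + L) (CleanBlockInput.suffix (qYE (n, (ℓ, (ℓR, Lq)))) (n * ℓ + L)) (stdBase n ℓ ℓY ℓR bc L)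
/-- Top of the erasing block's work window. [folklore] -/
def topX : ℕ :=
  CleanPlaced.top eX MX (n * ℓY + n * ℓR + n * bc + L)
    (CleanBlockInput.suffix (qXE (n, (ℓ, (ℓY, (ℓR, (bc, Lq)))))) (n * ℓY + n * ℓR + n * bc + L)) (stdBase n ℓ ℓY ℓR bc L)

/-- **The blocks fit** in any register at least as wide as the three tops. [folklore] -/
theorem stdLayout_fits {W : ℕ} (hW : 0 < W) (hY : topY n ℓ ℓY ℓR bc L Lq ≤ W) (hS : topS n ℓ ℓY ℓR bc L Lq ≤ W)
    (hX : topX n ℓ ℓY ℓR bc L Lq ≤ W) : Fits (stdLayout n ℓ ℓY ℓR bc L Lq W hW) where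
  fitY := hY
  fitS := hS
  fitX := hX

/-! ### The standard width -/

/-- **The standard register width**: one more than the largest block top and the Fourier room
`base + n·qbsize ℓ_R k_F`. [folklore] -/
def stdW (kF : ℕ) : ℕ :=
  max (max (topY n ℓ ℓY ℓR bc L Lq) (max (topS n ℓ ℓY ℓR bc L Lq) (topX n ℓ ℓY ℓR bc L Lq)))
    (stdBase n ℓ ℓY ℓR bc L + n * QFTKit.qbsize ℓR kF) + 1

variable (kF : ℕ)

/-- The standard width is positive. [folklore] -/
theorem stdW_pos : 0 < stdW n ℓ ℓY ℓR bc L Lq kF := Nat.succ_pos _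

/-- The blocks fit in the standard width. [folklore] -/
theorem fits_stdW : Fits (stdLayout n ℓ ℓY ℓR bc L Lq (stdW n ℓ ℓY ℓR bc L Lq kF) (stdW_pos n ℓ ℓY ℓR bc L Lq kF)) := by
  refine stdLayout_fits n ℓ ℓY ℓR bc L Lq _ ?_ ?_ ?_ <;> unfold stdW <;> omega

/-- The Fourier stage has room in the standard width. [folklore] -/
theorem room_stdW : (stdLayout n ℓ ℓY ℓR bc L Lq (stdW n ℓ ℓY ℓR bc L Lq kF) (stdW_pos n ℓ ℓY ℓR bc L Lq kF)).base +
    n * QFTKit.qbsize ((stdLayout n ℓ ℓY ℓR bc L Lq (stdW n ℓ ℓY ℓR bc L Lq kF) (stdW_pos n ℓ ℓY ℓR bc L Lq kF)).ℓR) kF ≤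
      stdW n ℓ ℓY ℓR bc L Lq kF := by
  show stdBase n ℓ ℓY ℓR bc L + n * QFTKit.qbsize ℓR kF ≤ stdW n ℓ ℓY ℓR bc L Lq kF
  unfold stdW; omega

/-- The zones fit in the standard width. [folklore] -/
theorem stdBase_le_stdW : stdBase n ℓ ℓY ℓR bc L ≤ stdW n ℓ ℓY ℓR bc L Lq kF := by unfold stdW; omega

/-- **The standard layout in the standard width is well formed.** [folklore] -/
theorem OK_stdW (hLq : Lq ≤ L) (hX : n * ℓ ≤ L) (hY : n * ℓY ≤ L) (hS : n * ℓR ≤ L) :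
    (stdLayout n ℓ ℓY ℓR bc L Lq (stdW n ℓ ℓY ℓR bc L Lq kF) (stdW_pos n ℓ ℓY ℓR bc L Lq kF)).OK :=
  stdLayout_OK n ℓ ℓY ℓR bc L Lq _ hLq hX hY hS (stdBase_le_stdW n ℓ ℓY ℓR bc L Lq kF)

/-- The schedule fields of the standard layout (for rewriting the machine theorems' schedule hypotheses). [folklore] -/
theorem stdLayout_fields (W : ℕ) (hW : 0 < W) :
    (stdLayout n ℓ ℓY ℓR bc L Lq W hW).ℓ = ℓ ∧ (stdLayout n ℓ ℓY ℓR bc L Lq W hW).ℓY = ℓY ∧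
      (stdLayout n ℓ ℓY ℓR bc L Lq W hW).ℓR = ℓR ∧ (stdLayout n ℓ ℓY ℓR bc L Lq W hW).bc = bc ∧
      (stdLayout n ℓ ℓY ℓR bc L Lq W hW).L = L ∧ (stdLayout n ℓ ℓY ℓR bc L Lq W hW).Lq = Lq ∧
      (stdLayout n ℓ ℓY ℓR bc L Lq W hW).base = stdBase n ℓ ℓY ℓR bc L :=
  ⟨rfl, rfl, rfl, rfl, rfl, rfl, rfl⟩

end SamplerClassical

end Regev2009

end Literature.Computability.Cryptography

end
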